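import Literature.AnabelianGeometry.AbsoluteAnabelian.AbsTopIII.DivisorSections
import HarnessLib

/-!
# [AbsTopIII] Prop. 1.6 (ii): well-definedness of the typed divisor cocycle (FACT-LIST F-0351)

S. Mochizuki, *Topics in absolute anabelian geometry III: global reconstruction algorithms*
[MochizukiAbsTopIII2015]; kurims manuscript pages (`paper:url-5493eb38cbb7`): Prop. 1.6 (ii) p. 35
(setting p. 34).

PROOF-ONLY companion (no definition, no instance) of the trunk file `AbsTopIII/DivisorSections.lean`
(abc-iut-L4-t1 lineage; FACT-LIST row **F-0351** `AbsTopIII.DivisorCurveModel.Prop_1_6_ii`), abc-iut cell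
seat abc-iut-f-080 (block F).  Print's Prop. 1.6 (ii) speaks of "the section `t_D : G_k → Π_J`" of a
degree-zero divisor `D` supported on `k`-rational points, built from the sections "`s_x : G_k → Π_X`
[well-defined up to conjugation by `Δ_X`]", and compares it "[up to conjugation by `Δ_X`]" with the
identity section.  The trunk file types this through TWO auxiliary choices that print does not make:
a base section `s₀` (the cocycle `divisorCocycle n s s₀` of `t_D` is measured against `d · t₀`, and
"coincides with the identity section" becomes `IsPrincipalCocycle s₀`, whose `G`-action `sectionAct s₀`
is conjugation through `t₀`), and a CHOICE of the sections `s_x` inside their `Δ`-conjugacy classes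
(the field `DivisorCurveModel.ptSection`).  This file proves that the typed left-hand side of
`Prop_1_6_ii` does not depend on either choice, i.e. that the typing is faithful to print's
"well-defined up to conjugation" on the nose:

* `sectionAct_eq` — the `G`-action on `Δ^ab` through a section does not depend on the section (the
  trunk docstring of `sectionAct` records this as "not proved here");
* `divisorCocycle_eq_mul_prod_zpow` — changing the base section `s₀ ↦ s₁` multiplies the divisor cocycle
  by `δ(s₁,s₀)^{deg D}`; hence (`divisorCocycle_eq_of_sum_eq_zero`) for `deg D = 0` the cocycle is
  literally independent of `s₀` (the trunk docstring's claim), and (`isPrincipalCocycle_iff_of_section`)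
  principality does not depend on the section used for the action;
* `isPrincipalCocycle_divisorCocycle_conj_iff` — replacing each point section `s_{x_i}` by a
  `Δ`-conjugate changes the divisor cocycle by a coboundary, so its principality is unchanged;
* at the level of a model `M : DivisorCurveModel`: `isPrincipalCocycle_divisorCocycleOf_iff_of_sections`
  (the typed LHS of `Prop_1_6_ii` is the same proposition for every base section), the instance `D = 0`
  of the typed biconditional at EVERY model (`prop_1_6_ii_zero`), and closure of principal cocycles
  under the group law (print's "`ℤ`-linear combinations"; for principal divisors this is already
  `DivisorCurveModel.IsPrincipal.add` / `.neg` of `Thm19cProofs.lean`).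

Consequently F-0351 can only be refuted through the GEOMETRY of a model (as the junk model of
`DivisorSectionsSchemaNegative.lean` does), never through the auxiliary choices of the typing.  Refereed
pre-IUT material; nothing here bears on [IUTchIII] Cor. 3.12 or takes a side; typed ≠ proved.
-/

noncomputable section

open scoped Classical IsMulCommutative

namespace Literature.AnabelianGeometry.AbsoluteAnabelian.AbsTopIII

universe u

variable {E : FundamentalExtension.{u}}

/-! ### Cocycle algebra of the differences `δ(s,t) = t_s · t_t⁻¹` -/

/-- `t_s(σ) = δ(s,t)(σ) · t_t(σ)`. [cite: MochizukiAbsTopIII2015, Prop 1.6 (ii) p.35] -/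
theorem sectionJ1_eq_sectionDiff_mul (s t : E.Section) (σ : E.gal) :
    sectionJ1 s σ = (sectionDiff s t σ : PiJ1 E) * sectionJ1 t σ := by
  rw [coe_sectionDiff, inv_mul_cancel_right]

/-- The cocycle identity `δ(s,t) · δ(t,r) = δ(s,r)`. [cite: MochizukiAbsTopIII2015, Prop 1.6 (ii) p.35] -/
theorem sectionDiff_mul_sectionDiff (s t r : E.Section) (σ : E.gal) :
    sectionDiff s t σ * sectionDiff t r σ = sectionDiff s r σ := by
  apply Subtype.ext
  simp only [Subgroup.coe_mul, coe_sectionDiff]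
  group

/-- `δ(s,t)⁻¹ = δ(t,s)`. [cite: MochizukiAbsTopIII2015, Prop 1.6 (ii) p.35] -/
theorem sectionDiff_inv (s t : E.Section) (σ : E.gal) :
    (sectionDiff s t σ)⁻¹ = sectionDiff t s σ := by
  apply Subtype.ext
  simp only [Subgroup.coe_inv, coe_sectionDiff, mul_inv_rev, inv_inv]

/-- Base change of a difference: `δ(s,s₀) = δ(s,s₁) · δ(s₁,s₀)`.
[cite: MochizukiAbsTopIII2015, Prop 1.6 (ii) p.35] -/
theorem sectionDiff_eq_mul_sectionDiff (s s₀ s₁ : E.Section) (σ : E.gal) :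
    sectionDiff s s₀ σ = sectionDiff s s₁ σ * sectionDiff s₁ s₀ σ :=
  (sectionDiff_mul_sectionDiff s s₁ s₀ σ).symm

/-! ### The `G`-action on `Δ^ab` does not depend on the section -/

/-- **`sectionAct` is independent of the section** (trunk docstring of `sectionAct`: "independent of the
section since `Δ^ab` is abelian — not proved here"): `t₀(σ) a t₀(σ)⁻¹ = t₁(σ) a t₁(σ)⁻¹` for
`a ∈ Δ^ab`, because `t₀(σ) = δ(s₀,s₁)(σ) · t₁(σ)` with `δ(s₀,s₁)(σ) ∈ Δ^ab` commuting with
`t₁(σ) a t₁(σ)⁻¹ ∈ Δ^ab`. [cite: MochizukiAbsTopIII2015, Prop 1.6 (ii) p.35] -/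
theorem sectionAct_apply_eq (s₀ s₁ : E.Section) (σ : E.gal) (a : geomAbelianized E) :
    sectionAct s₀ σ a = sectionAct s₁ σ a := by
  have hcomm : ((sectionDiff s₀ s₁ σ : geomAbelianized E) : PiJ1 E) * (sectionAct s₁ σ a : PiJ1 E)
      = (sectionAct s₁ σ a : PiJ1 E) * (sectionDiff s₀ s₁ σ : PiJ1 E) := by
    rw [← Subgroup.coe_mul, ← Subgroup.coe_mul, mul_comm]
  rw [coe_sectionAct] at hcomm
  apply Subtype.ext
  rw [coe_sectionAct, coe_sectionAct, sectionJ1_eq_sectionDiff_mul s₀ s₁ σ]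
  calc (sectionDiff s₀ s₁ σ : PiJ1 E) * sectionJ1 s₁ σ * a
          * ((sectionDiff s₀ s₁ σ : PiJ1 E) * sectionJ1 s₁ σ)⁻¹
        = (sectionDiff s₀ s₁ σ : PiJ1 E) * (sectionJ1 s₁ σ * a * (sectionJ1 s₁ σ)⁻¹)
            * (sectionDiff s₀ s₁ σ : PiJ1 E)⁻¹ := by group
    _ = (sectionJ1 s₁ σ * a * (sectionJ1 s₁ σ)⁻¹) * (sectionDiff s₀ s₁ σ : PiJ1 E)
            * (sectionDiff s₀ s₁ σ : PiJ1 E)⁻¹ := by rw [hcomm]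
    _ = sectionJ1 s₁ σ * a * (sectionJ1 s₁ σ)⁻¹ := mul_inv_cancel_right _ _

/-- **`sectionAct s₀ σ = sectionAct s₁ σ`** as endomorphisms of `Δ^ab`.
[cite: MochizukiAbsTopIII2015, Prop 1.6 (ii) p.35] -/
theorem sectionAct_eq (s₀ s₁ : E.Section) (σ : E.gal) : sectionAct s₀ σ = sectionAct s₁ σ :=
  MonoidHom.ext (sectionAct_apply_eq s₀ s₁ σ)

/-- Principality of a cocycle does not depend on the section through which `G` acts on `Δ^ab`.
[cite: MochizukiAbsTopIII2015, Prop 1.6 (ii) p.35] -/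
theorem isPrincipalCocycle_iff_of_section (s₀ s₁ : E.Section) (c : E.gal → geomAbelianized E) :
    IsPrincipalCocycle s₀ c ↔ IsPrincipalCocycle s₁ c := by
  simp only [IsPrincipalCocycle, sectionAct_eq s₀ s₁]

/-! ### Principal cocycles form a subgroup containing the coboundaries -/

/-- A coboundary `σ ↦ A · (σ·A)⁻¹` is principal. [cite: MochizukiAbsTopIII2015, Prop 1.6 (ii) p.35] -/
theorem isPrincipalCocycle_coboundary (s₀ : E.Section) (A : geomAbelianized E) :
    IsPrincipalCocycle s₀ fun σ => A * (sectionAct s₀ σ A)⁻¹ :=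
  ⟨A, fun _ => rfl⟩

/-- Principal cocycles are closed under pointwise products.
[cite: MochizukiAbsTopIII2015, Prop 1.6 (ii) p.35] -/
theorem IsPrincipalCocycle.mul {s₀ : E.Section} {c c' : E.gal → geomAbelianized E}
    (hc : IsPrincipalCocycle s₀ c) (hc' : IsPrincipalCocycle s₀ c') :
    IsPrincipalCocycle s₀ fun σ => c σ * c' σ := by
  obtain ⟨a, ha⟩ := hc
  obtain ⟨a', ha'⟩ := hc'
  refine ⟨a * a', fun σ => ?_⟩
  change c σ * c' σ = _
  rw [ha σ, ha' σ, map_mul, mul_inv, mul_mul_mul_comm]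

/-- Principal cocycles are closed under pointwise inverses.
[cite: MochizukiAbsTopIII2015, Prop 1.6 (ii) p.35] -/
theorem IsPrincipalCocycle.inv {s₀ : E.Section} {c : E.gal → geomAbelianized E}
    (hc : IsPrincipalCocycle s₀ c) : IsPrincipalCocycle s₀ fun σ => (c σ)⁻¹ := by
  obtain ⟨a, ha⟩ := hc
  refine ⟨a⁻¹, fun σ => ?_⟩
  change (c σ)⁻¹ = _
  rw [ha σ, map_inv, mul_inv]

/-- Multiplying a cocycle by a coboundary does not change its principality.
[cite: MochizukiAbsTopIII2015, Prop 1.6 (ii) p.35] -/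
theorem isPrincipalCocycle_coboundary_mul_iff (s₀ : E.Section) (A : geomAbelianized E)
    (c : E.gal → geomAbelianized E) :
    IsPrincipalCocycle s₀ (fun σ => A * (sectionAct s₀ σ A)⁻¹ * c σ) ↔ IsPrincipalCocycle s₀ c := by
  refine ⟨fun h => ?_, fun h => (isPrincipalCocycle_coboundary s₀ A).mul h⟩
  have h' := (isPrincipalCocycle_coboundary s₀ A).inv.mul h
  have hc : c = fun σ => (A * (sectionAct s₀ σ A)⁻¹)⁻¹ * (A * (sectionAct s₀ σ A)⁻¹ * c σ) :=
    funext fun σ => (inv_mul_cancel_left _ _).symm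
  rw [hc]
  exact h'

/-! ### Base change `s₀ ↦ s₁` of the divisor cocycle -/

/-- `∏_i a^{f i} = a^{Σ_i f i}` for integer exponents (the `ℤ`-analogue of Mathlib's
`Finset.prod_pow_eq_pow_sum`). [cite: MochizukiAbsTopIII2015, Prop 1.6 (ii) p.35] -/
theorem prod_zpow_eq_zpow_sum {G : Type u} [CommGroup G] {ι : Type u} (S : Finset ι) (f : ι → ℤ)
    (a : G) : ∏ i ∈ S, a ^ f i = a ^ ∑ i ∈ S, f i :=
  Finset.cons_induction (by simp)
    (fun _ _ _ h => by simp only [Finset.prod_cons, Finset.sum_cons, zpow_add, h]) S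

/-- **Base change of the divisor cocycle**: `c_{D,s₀}(σ) = c_{D,s₁}(σ) · δ(s₁,s₀)(σ)^{deg D}` with
`deg D = Σ_i n_i` — the exact discrepancy, which is why the trunk types only the `d = 0` criterion
through a base section. [cite: MochizukiAbsTopIII2015, Prop 1.6 (ii) p.35] -/
theorem divisorCocycle_eq_mul_zpow_sum {ι : Type u} [Fintype ι] (n : ι → ℤ) (s : ι → E.Section)
    (s₀ s₁ : E.Section) (σ : E.gal) :
    divisorCocycle n s s₀ σ = divisorCocycle n s s₁ σ * sectionDiff s₁ s₀ σ ^ ∑ i, n i := by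
  simp only [divisorCocycle]
  rw [← prod_zpow_eq_zpow_sum, ← Finset.prod_mul_distrib]
  refine Finset.prod_congr rfl fun i _ => ?_
  rw [sectionDiff_eq_mul_sectionDiff (s i) s₀ s₁ σ, mul_zpow]

/-- **Independence of the base section for degree zero** (trunk docstring of `divisorCocycle`: "for
`Σ n_i = 0` this function does not depend on `s₀`"). [cite: MochizukiAbsTopIII2015, Prop 1.6 (ii) p.35] -/
theorem divisorCocycle_eq_of_sum_eq_zero {ι : Type u} [Fintype ι] (n : ι → ℤ) (s : ι → E.Section)
    (hn : ∑ i, n i = 0) (s₀ s₁ : E.Section) : divisorCocycle n s s₀ = divisorCocycle n s s₁ := by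
  funext σ
  rw [divisorCocycle_eq_mul_zpow_sum n s s₀ s₁ σ, hn, zpow_zero, mul_one]

/-- For a degree-zero divisor, principality of the divisor cocycle is ONE proposition, the same for
every pair of base sections used for the cocycle and for the action.
[cite: MochizukiAbsTopIII2015, Prop 1.6 (ii) p.35] -/
theorem isPrincipalCocycle_divisorCocycle_iff_of_sum_eq_zero {ι : Type u} [Fintype ι] (n : ι → ℤ)
    (s : ι → E.Section) (hn : ∑ i, n i = 0) (s₀ s₁ : E.Section) :
    IsPrincipalCocycle s₀ (divisorCocycle n s s₀) ↔ IsPrincipalCocycle s₁ (divisorCocycle n s s₁) := by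
  rw [divisorCocycle_eq_of_sum_eq_zero n s hn s₀ s₁]
  exact isPrincipalCocycle_iff_of_section s₀ s₁ _

/-! ### The divisor cocycle is additive in the divisor -/

/-- `c_{D+D'} = c_D · c_{D'}` (same support family). [cite: MochizukiAbsTopIII2015, Prop 1.6 (ii) p.35] -/
theorem divisorCocycle_add {ι : Type u} [Fintype ι] (n m : ι → ℤ) (s : ι → E.Section)
    (s₀ : E.Section) (σ : E.gal) :
    divisorCocycle (n + m) s s₀ σ = divisorCocycle n s s₀ σ * divisorCocycle m s s₀ σ := by
  simp only [divisorCocycle, Pi.add_apply, zpow_add, Finset.prod_mul_distrib]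

/-- `c_{−D} = c_D⁻¹`. [cite: MochizukiAbsTopIII2015, Prop 1.6 (ii) p.35] -/
theorem divisorCocycle_neg {ι : Type u} [Fintype ι] (n : ι → ℤ) (s : ι → E.Section)
    (s₀ : E.Section) (σ : E.gal) :
    divisorCocycle (-n) s s₀ σ = (divisorCocycle n s s₀ σ)⁻¹ := by
  simp only [divisorCocycle, Pi.neg_apply, zpow_neg, Finset.prod_inv_distrib]

/-- The divisors (on a fixed family of sections) with principal cocycle are closed under addition.
[cite: MochizukiAbsTopIII2015, Prop 1.6 (ii) p.35] -/
theorem isPrincipalCocycle_divisorCocycle_add {ι : Type u} [Fintype ι] {n m : ι → ℤ}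
    {s : ι → E.Section} {s₀ : E.Section} (hn : IsPrincipalCocycle s₀ (divisorCocycle n s s₀))
    (hm : IsPrincipalCocycle s₀ (divisorCocycle m s s₀)) :
    IsPrincipalCocycle s₀ (divisorCocycle (n + m) s s₀) := by
  have h := hn.mul hm
  simp only [← divisorCocycle_add] at h
  exact h

/-- The divisors (on a fixed family of sections) with principal cocycle are closed under negation.
[cite: MochizukiAbsTopIII2015, Prop 1.6 (ii) p.35] -/
theorem isPrincipalCocycle_divisorCocycle_neg {ι : Type u} [Fintype ι] {n : ι → ℤ}
    {s : ι → E.Section} {s₀ : E.Section} (hn : IsPrincipalCocycle s₀ (divisorCocycle n s s₀)) :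
    IsPrincipalCocycle s₀ (divisorCocycle (-n) s s₀) := by
  have h := hn.inv
  simp only [← divisorCocycle_neg] at h
  exact h

/-! ### Replacing the point sections `s_x` by `Δ`-conjugates -/

/-- `t_{s^d}(σ) = d̄ · t_s(σ) · d̄⁻¹` for the `Δ`-conjugate `s^d` of a section (`d̄` the image of `d` in
`Π_{J¹}`). [cite: MochizukiAbsTopIII2015, Prop 1.6 (ii) p.35] -/
theorem sectionJ1_conj (s : E.Section) (d : E.geom) (σ : E.gal) :
    sectionJ1 (s.conj d) σ =
      (QuotientGroup.mk (d : E.arith) : PiJ1 E) * sectionJ1 s σ * (QuotientGroup.mk (d : E.arith))⁻¹ := by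
  change (QuotientGroup.mk' (geomCommutatorClosure E) ((d : E.arith) * s.toHom σ * (d : E.arith)⁻¹) :
      PiJ1 E) = _
  rw [map_mul, map_mul, map_inv]
  rfl

/-- The image `d̄` of `d ∈ Δ` in `Π_{J¹}` lies in `Δ^ab`. [cite: MochizukiAbsTopIII2015, Prop 1.6 (ii) p.35] -/
theorem mk_mem_geomAbelianized (d : E.geom) :
    (QuotientGroup.mk (d : E.arith) : PiJ1 E) ∈ geomAbelianized E :=
  Subgroup.mem_map.mpr ⟨d, d.2, rfl⟩

/-- **`Δ`-conjugating a point section changes its difference cocycle by a coboundary**: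
`δ(s^d, s₀)(σ) = d̄ · (σ·d̄)⁻¹ · δ(s, s₀)(σ)`. [cite: MochizukiAbsTopIII2015, Prop 1.6 (ii) p.35] -/
theorem sectionDiff_conj (s s₀ : E.Section) {d : E.geom} {a : geomAbelianized E}
    (ha : (a : PiJ1 E) = QuotientGroup.mk (d : E.arith)) (σ : E.gal) :
    sectionDiff (s.conj d) s₀ σ = a * (sectionAct s₀ σ a)⁻¹ * sectionDiff s s₀ σ := by
  rw [sectionAct_apply_eq s₀ s σ a]
  apply Subtype.ext
  simp only [Subgroup.coe_mul, Subgroup.coe_inv, coe_sectionDiff, coe_sectionAct, sectionJ1_conj, ha]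
  group

/-- **`Δ`-conjugating the point sections changes the divisor cocycle by a coboundary**: with
`A := ∏_i d̄_i^{n_i} ∈ Δ^ab`, `c_{D,(s_i^{d_i})}(σ) = A · (σ·A)⁻¹ · c_{D,(s_i)}(σ)`.
[cite: MochizukiAbsTopIII2015, Prop 1.6 (ii) p.35] -/
theorem divisorCocycle_conj {ι : Type u} [Fintype ι] (n : ι → ℤ) (s : ι → E.Section)
    (d : ι → E.geom) (a : ι → geomAbelianized E)
    (ha : ∀ i, (a i : PiJ1 E) = QuotientGroup.mk ((d i : E.geom) : E.arith))
    (s₀ : E.Section) (σ : E.gal) :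
    divisorCocycle n (fun i => (s i).conj (d i)) s₀ σ =
      (∏ i, a i ^ n i) * (sectionAct s₀ σ (∏ i, a i ^ n i))⁻¹ * divisorCocycle n s s₀ σ := by
  simp only [divisorCocycle, map_prod, map_zpow, ← Finset.prod_inv_distrib, ← Finset.prod_mul_distrib]
  refine Finset.prod_congr rfl fun i _ => ?_
  rw [sectionDiff_conj (s i) s₀ (ha i) σ, mul_zpow, mul_zpow, inv_zpow]

/-- **Principality of the divisor cocycle is invariant under `Δ`-conjugation of the point sections**
(print: "`s_x : G_k → Π_X` [...] well-defined up to conjugation by `Δ_X`", and `t_D` is compared with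
the identity section "up to conjugation by `Δ_X`"): the CHOICE of representatives `s_x` made by a
model's `ptSection` is immaterial to the typed left-hand side of Prop. 1.6 (ii).
[cite: MochizukiAbsTopIII2015, Prop 1.6 (ii) p.35] -/
theorem isPrincipalCocycle_divisorCocycle_conj_iff {ι : Type u} [Fintype ι] (n : ι → ℤ)
    (s : ι → E.Section) (d : ι → E.geom) (s₀ : E.Section) :
    IsPrincipalCocycle s₀ (divisorCocycle n (fun i => (s i).conj (d i)) s₀) ↔
      IsPrincipalCocycle s₀ (divisorCocycle n s s₀) := by
  have key : divisorCocycle n (fun i => (s i).conj (d i)) s₀ = fun σ =>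
      (∏ i, (⟨_, mk_mem_geomAbelianized (d i)⟩ : geomAbelianized E) ^ n i)
        * (sectionAct s₀ σ (∏ i, (⟨_, mk_mem_geomAbelianized (d i)⟩ : geomAbelianized E) ^ n i))⁻¹
        * divisorCocycle n s s₀ σ :=
    funext fun σ => divisorCocycle_conj n s d _ (fun _ => rfl) s₀ σ
  rw [key]
  exact isPrincipalCocycle_coboundary_mul_iff s₀ _ _

/-! ### At the level of a model `M : DivisorCurveModel` -/

namespace DivisorCurveModel

variable (M : DivisorCurveModel.{u})

/-- **The typed LHS of `Prop_1_6_ii` does not depend on the base section**: for a degree-zero divisor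
`D` supported on rational points, `IsPrincipalCocycle s₀ (M.divisorCocycleOf D hD s₀)` is the same
proposition for all base sections `s₀`. [cite: MochizukiAbsTopIII2015, Prop 1.6 (ii) p.35] -/
theorem divisorCocycleOf_eq_of_sum_eq_zero {X : M.Curve} (D : M.Point X →₀ ℤ)
    (hD : ∀ x ∈ D.support, M.IsRationalPt X x) (hdeg : (∑ x ∈ D.support, D x) = 0)
    (s₀ s₁ : (M.ext X).Section) : M.divisorCocycleOf D hD s₀ = M.divisorCocycleOf D hD s₁ := by
  have h : (∑ x : ↥D.support, D x) = 0 := by rwa [Finset.sum_coe_sort]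
  exact divisorCocycle_eq_of_sum_eq_zero _ _ h s₀ s₁

/-- **Corollary**: the left-hand side of the typed biconditional of `Prop_1_6_ii` at `(X, D)` is
independent of the quantified base section `s₀` — the `∀ s₀` of the typed statement is over a
constant family, exactly as print (which uses no base section) presupposes.
[cite: MochizukiAbsTopIII2015, Prop 1.6 (ii) p.35] -/
theorem isPrincipalCocycle_divisorCocycleOf_iff_of_sections {X : M.Curve} (D : M.Point X →₀ ℤ)
    (hD : ∀ x ∈ D.support, M.IsRationalPt X x) (hdeg : (∑ x ∈ D.support, D x) = 0)
    (s₀ s₁ : (M.ext X).Section) :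
    IsPrincipalCocycle s₀ (M.divisorCocycleOf D hD s₀) ↔
      IsPrincipalCocycle s₁ (M.divisorCocycleOf D hD s₁) := by
  rw [M.divisorCocycleOf_eq_of_sum_eq_zero D hD hdeg s₀ s₁]
  exact isPrincipalCocycle_iff_of_section s₀ s₁ _

/-- **The typed LHS of `Prop_1_6_ii` does not depend on the representatives `s_x` chosen by the
model inside their `Δ`-conjugacy classes**: conjugating each point section `M.ptSection x` (for `x` in
the support) by any `d_x ∈ Δ` leaves the principality of the divisor cocycle unchanged.
[cite: MochizukiAbsTopIII2015, Prop 1.6 (ii) p.35] -/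
theorem isPrincipalCocycle_divisorCocycleOf_conj_iff {X : M.Curve} (D : M.Point X →₀ ℤ)
    (hD : ∀ x ∈ D.support, M.IsRationalPt X x) (d : ↥D.support → (M.ext X).geom)
    (s₀ : (M.ext X).Section) :
    IsPrincipalCocycle s₀
        (divisorCocycle (ι := ↥D.support) (fun x => D x)
          (fun x => (M.ptSection x.1 (hD x.1 x.2)).conj (d x)) s₀) ↔
      IsPrincipalCocycle s₀ (M.divisorCocycleOf D hD s₀) :=
  isPrincipalCocycle_divisorCocycle_conj_iff _ _ d s₀

/-- The divisor cocycle of the zero divisor of a model is trivial.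
[cite: MochizukiAbsTopIII2015, Prop 1.6 (ii) p.35] -/
theorem divisorCocycleOf_zero {X : M.Curve}
    (hD : ∀ x ∈ (0 : M.Point X →₀ ℤ).support, M.IsRationalPt X x) (s₀ : (M.ext X).Section) :
    M.divisorCocycleOf 0 hD s₀ = fun _ => 1 := by
  funext σ
  change divisorCocycle (fun x : ↥(0 : M.Point X →₀ ℤ).support => ((0 : M.Point X →₀ ℤ) x : ℤ))
    _ s₀ σ = 1
  simp [divisorCocycle]

/-- **The instance `D = 0` of the typed biconditional of Prop. 1.6 (ii) holds at EVERY model** (both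
sides are true: the trivial cocycle is principal and `0 = div(1)`; the right-hand side is also
`DivisorCurveModel.isPrincipal_zero` of `Thm19PUgtProofs.lean`, and principal divisors are closed under
the group law by `DivisorCurveModel.IsPrincipal.add` / `.neg` of `Thm19cProofs.lean`); in particular a
refutation of the schema `∀ M, M.Prop_1_6_ii` must use a nonzero divisor, as
`DivisorSectionsSchemaNegative.lean` does. [cite: MochizukiAbsTopIII2015, Prop 1.6 (ii) p.35] -/
theorem prop_1_6_ii_zero {X : M.Curve}
    (hD : ∀ x ∈ (0 : M.Point X →₀ ℤ).support, M.IsRationalPt X x) (s₀ : (M.ext X).Section) :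
    IsPrincipalCocycle s₀ (M.divisorCocycleOf 0 hD s₀) ↔ M.IsPrincipal (0 : M.Point X →₀ ℤ) := by
  rw [M.divisorCocycleOf_zero hD s₀]
  exact iff_of_true (isPrincipalCocycle_one s₀) ⟨1, fun x => by simp⟩

end DivisorCurveModel

end Literature.AnabelianGeometry.AbsoluteAnabelian.AbsTopIII

end
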